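import Mathlib.Analysis.Calculus.Deriv.Polynomial
import Mathlib.Analysis.Calculus.ContDiff.Polynomial
import Mathlib.Algebra.Polynomial.Roots
import Summits.Ventures.KdS.SpinFlipAnalysis
import HarnessLib

/-!
# Venture KdS — analysis toolkit for the Teukolsky–Starobinsky transfer (II): polynomial rigidity
# and the injectivity lemma

HONEST FRAMING (venture `Summits/Ventures/KdS`, cell `pub-kds`): elementary real analysis used by
`RouteWSpinFlip.lean`. Nothing here mentions Kerr–de Sitter. Contents:

* `exists_polynomial_of_iterate_deriv_eq_zero`: `f^{(N)} ≡ 0` on an open interval forces `f` to be a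
  polynomial of degree `< N` there (induction with explicit antiderivatives and the mean value
  theorem);
* `eq_zero_of_iterate_deriv_eq_zero_of_branch`: the INJECTIVITY LEMMA — a function on `(0,1)` with
  `u^{(N)} ≡ 0` which is `(1−x)^μ ·(smooth across 1)` near `1⁻` vanishes identically unless
  `μ ∈ ℤ_{≤ N−1}` (the "cosmological lattice" of the spin-flip theorem: there the kernel of the
  `2s`-th derivative contains functions with the physical branch at the cosmological horizon).
-/

noncomputable section

open Set Complex Filter Topology Polynomial

namespace Summit.Ventures.KdS

namespace SpinFlipTS

open Literature.Geometry.Lorentzian.Kerr.Costa2019 (iterate_deriv_smooth iterate_deriv_eqOn)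

/-! ### Vanishing `N`-th derivative on an interval ⇒ polynomial -/

/-- An explicit antiderivative of a polynomial: `(∑ c_i/(i+1) X^{i+1})' = ∑ c_i X^i`. -/
private theorem exists_antiderivative (P : Polynomial ℂ) :
    ∃ Q : Polynomial ℂ, Q.derivative = P ∧ Q.natDegree ≤ P.natDegree + 1 := by
  set n := P.natDegree + 1 with hn
  refine ⟨∑ i ∈ Finset.range n, C (P.coeff i / ((i : ℂ) + 1)) * X ^ (i + 1), ?_, ?_⟩
  · rw [derivative_sum]
    conv_rhs => rw [as_sum_range_C_mul_X_pow' P (show P.natDegree < n by omega)]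
    refine Finset.sum_congr rfl fun i _ => ?_
    rw [derivative_C_mul_X_pow]
    have hi : (i : ℂ) + 1 ≠ 0 := by exact_mod_cast Nat.succ_ne_zero i
    congr 1
    · push_cast
      field_simp
    -- `X ^ (i + 1 - 1) = X ^ i`
  · refine (natDegree_sum_le_of_forall_le _ _ fun i hi => ?_)
    calc (C (P.coeff i / ((i : ℂ) + 1)) * X ^ (i + 1)).natDegree ≤ i + 1 := natDegree_C_mul_X_pow_le _ _
      _ ≤ P.natDegree + 1 := by
        have := Finset.mem_range.mp hi
        omega

/-- Two points of an open interval: a function with zero derivative on the interval takes equal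
values (mean value theorem on the segment). -/
private theorem eq_of_hasDerivAt_zero {a b : ℝ} {g : ℝ → ℂ}
    (hg : ∀ x ∈ Ioo a b, HasDerivAt g 0 x) {x y : ℝ} (hx : x ∈ Ioo a b) (hy : y ∈ Ioo a b)
    (hxy : x ≤ y) : g y = g x := by
  have hsub : Icc x y ⊆ Ioo a b := fun t ht => ⟨lt_of_lt_of_le hx.1 ht.1, lt_of_le_of_lt ht.2 hy.2⟩
  have hcont : ContinuousOn g (Icc x y) := fun t ht =>
    (hg t (hsub ht)).continuousAt.continuousWithinAt
  exact constant_of_has_deriv_right_zero hcont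
    (fun t ht => (hg t (hsub ⟨ht.1, ht.2.le⟩)).hasDerivWithinAt) y ⟨hxy, le_rfl⟩

/-- **`f^{(N)} ≡ 0` on an open interval forces `f` to be a polynomial of degree `< N` there.** -/
theorem exists_polynomial_of_iterate_deriv_eq_zero {a b : ℝ} (hab : a < b) :
    ∀ (N : ℕ) {f : ℝ → ℂ}, ContDiffOn ℝ ((⊤ : ℕ∞) : WithTop ℕ∞) f (Ioo a b) →
      (∀ x ∈ Ioo a b, (deriv^[N] f) x = 0) →
        ∃ P : Polynomial ℂ, P.degree < N ∧ ∀ x ∈ Ioo a b, f x = P.eval (x : ℂ) := by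
  intro N
  induction N with
  | zero =>
    intro f _ h0
    refine ⟨0, by simp, fun x hx => ?_⟩
    simpa using h0 x hx
  | succ N ih =>
    intro f hf hN
    have hI : IsOpen (Ioo a b) := isOpen_Ioo
    -- `deriv f` is smooth and its `N`-th derivative vanishes
    obtain ⟨hf1, hfd⟩ := iterate_deriv_smooth hI hf 1
    simp only [Function.iterate_one] at hf1
    have hN' : ∀ x ∈ Ioo a b, (deriv^[N] (deriv f)) x = 0 := by
      intro x hx
      have := hN x hx
      rwa [Function.iterate_succ_apply] at this
    obtain ⟨P, hPdeg, hP⟩ := ih hf1 hN'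
    -- antiderivative `Q` of `P`, and `f − Q` has zero derivative
    obtain ⟨Q, hQ, hQdeg⟩ : ∃ Q : Polynomial ℂ, Q.derivative = P ∧ Q.natDegree ≤ N := by
      by_cases hP0 : P = 0
      · exact ⟨0, by simp [hP0], by simp⟩
      · obtain ⟨Q, hQ, hQdeg⟩ := exists_antiderivative P
        have := (natDegree_lt_iff_degree_lt hP0).mpr hPdeg
        exact ⟨Q, hQ, hQdeg.trans (by omega)⟩
    have hderiv0 : ∀ x ∈ Ioo a b, HasDerivAt (fun t => f t - Q.eval (t : ℂ)) 0 x := by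
      intro x hx
      have h1 : HasDerivAt f (deriv f x) x :=
        ((hf.differentiableOn (by simp)).differentiableAt (hI.mem_nhds hx)).hasDerivAt
      have h2 : HasDerivAt (fun t : ℝ => Q.eval (t : ℂ)) (Q.derivative.eval (x : ℂ)) x :=
        (Q.hasDerivAt (x : ℂ)).comp_ofReal
      have h3 := h1.sub h2
      rw [hQ, ← hP x hx, sub_self] at h3
      exact h3
    -- hence `f = Q + c` on the interval
    set x₀ : ℝ := (a + b) / 2 with hx₀
    have hx₀I : x₀ ∈ Ioo a b := ⟨by rw [hx₀]; linarith, by rw [hx₀]; linarith⟩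
    set c : ℂ := f x₀ - Q.eval (x₀ : ℂ) with hc
    have hconst : ∀ x ∈ Ioo a b, f x - Q.eval (x : ℂ) = c := by
      intro x hx
      rcases le_total x₀ x with h | h
      · exact eq_of_hasDerivAt_zero hderiv0 hx₀I hx h
      · exact (eq_of_hasDerivAt_zero hderiv0 hx hx₀I h).symm
    refine ⟨Q + C c, ?_, fun x hx => ?_⟩
    · -- degree bound: `natDegree Q ≤ N`
      have h1 : (Q + C c).natDegree ≤ N := by
        calc (Q + C c).natDegree ≤ max Q.natDegree (C c).natDegree := natDegree_add_le _ _
          _ ≤ N := by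
            rw [natDegree_C]
            exact max_le hQdeg (Nat.zero_le _)
      calc (Q + C c).degree ≤ (Q + C c).natDegree := degree_le_natDegree
        _ ≤ (N : WithBot ℕ) := by exact_mod_cast h1
        _ < ((N + 1 : ℕ) : WithBot ℕ) := by exact_mod_cast Nat.lt_succ_self N
    · have := hconst x hx
      rw [eval_add, eval_C]
      linear_combination this

/-! ### The injectivity lemma -/

/-- A polynomial vanishing on a non-trivial real interval (evaluated on `ℝ ⊆ ℂ`) is zero. -/
private theorem polynomial_eq_zero_of_eval_eq_zero {P : Polynomial ℂ} {a b : ℝ} (hab : a < b)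
    (h : ∀ x ∈ Ioo a b, P.eval (x : ℂ) = 0) : P = 0 := by
  apply eq_zero_of_infinite_isRoot
  have hinf : (((↑) : ℝ → ℂ) '' Ioo a b).Infinite :=
    (Ioo_infinite hab).image Complex.ofReal_injective.injOn
  refine hinf.mono ?_
  rintro _ ⟨x, hx, rfl⟩
  exact h x hx

/-- **Injectivity lemma.** Let `u` be smooth on `(0,1)` with `u^{(N)} ≡ 0` there, and suppose that
near `1⁻`, `u(x) = (1−x)^μ G(x)` with `G` smooth on a two-sided neighbourhood of `1` (principal power
of the positive real `1−x`). If `μ ∉ ℤ_{≤ N−1}`, then `u ≡ 0` on `(0,1)`. (Indeed `u` is a polynomial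
`P` of degree `< N`; if `P ≠ 0`, write `P = (X−1)^n q`, `q(1) ≠ 0`, `n ≤ N−1`; then
`G = ±(1−x)^{n−μ} q` extends smoothly across `1`, forcing `n − μ ∈ ℕ`, i.e. `μ ∈ ℤ_{≤ n}`.) -/
theorem eq_zero_of_iterate_deriv_eq_zero_of_branch {N : ℕ} {u : ℝ → ℂ}
    (hu : ContDiffOn ℝ ((⊤ : ℕ∞) : WithTop ℕ∞) u (Ioo 0 1))
    (hN : ∀ x ∈ Ioo (0 : ℝ) 1, (deriv^[N] u) x = 0) {μ : ℂ} {e : ℝ} (he : 0 < e) (he1 : e ≤ 1)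
    {G : ℝ → ℂ} (hG : ContDiffOn ℝ ((⊤ : ℕ∞) : WithTop ℕ∞) G (Ioo (1 - e) (1 + e)))
    (hbranch : ∀ x ∈ Ioo (1 - e) 1, u x = ((1 - x : ℝ) : ℂ) ^ μ * G x)
    (hoff : ∀ k : ℤ, k ≤ (N : ℤ) - 1 → μ ≠ k) :
    ∀ x ∈ Ioo (0 : ℝ) 1, u x = 0 := by
  obtain ⟨P, hPdeg, hP⟩ := exists_polynomial_of_iterate_deriv_eq_zero zero_lt_one N hu hN
  by_cases hP0 : P = 0
  · intro x hx; simp [hP x hx, hP0]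
  exfalso
  set n := P.rootMultiplicity 1 with hn
  obtain ⟨q, hPq, hqdvd⟩ := exists_eq_pow_rootMultiplicity_mul_and_not_dvd P hP0 1
  have hq1 : q.eval 1 ≠ 0 := by
    intro h0; exact hqdvd (dvd_iff_isRoot.mpr h0)
  have hq0 : q ≠ 0 := by rintro rfl; simp at hq1
  -- `n ≤ natDegree P ≤ N − 1`
  have hnle : n ≤ P.natDegree := by
    have h := congrArg natDegree hPq
    rw [natDegree_mul (pow_ne_zero _ (X_sub_C_ne_zero 1)) hq0, natDegree_pow, natDegree_X_sub_C,
      mul_one] at h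
    omega
  have hPnat : P.natDegree < N := (natDegree_lt_iff_degree_lt hP0).mpr hPdeg
  -- the cofactor `Q(x) = (−1)^n q(x)` and the identity `(1−x)^{n−μ} Q(x) = G(x)` on `(1−e, 1)`
  set Q : ℝ → ℂ := fun x => (-1) ^ n * q.eval (x : ℂ) with hQdef
  have hQs : ContDiffOn ℝ ((⊤ : ℕ∞) : WithTop ℕ∞) Q (Ioo (1 - e) (1 + e)) := by
    have h1 : ContDiff ℝ ((⊤ : ℕ∞) : WithTop ℕ∞) (fun x : ℝ => q.eval (x : ℂ)) := by
      have hq0 : ContDiff ℂ ((⊤ : ℕ∞) : WithTop ℕ∞) (fun x : ℂ => aeval x q) :=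
        Polynomial.contDiff_aeval q _
      have hq := hq0.restrict_scalars ℝ
      have e1 : (fun x : ℂ => aeval x q) = fun x : ℂ => q.eval x := by
        funext x; simp [coe_aeval_eq_eval]
      rw [e1] at hq
      exact hq.comp Complex.ofRealCLM.contDiff
    exact (contDiff_const.mul h1).contDiffOn
  have hQ1 : Q 1 ≠ 0 := by
    rw [hQdef]
    simp only [Complex.ofReal_one]
    exact mul_ne_zero (pow_ne_zero _ (by norm_num)) hq1
  have hagree : ∀ x ∈ Ioo (1 - e) 1, ((1 - x : ℝ) : ℂ) ^ ((n : ℂ) - μ) * Q x = G x := by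
    intro x hx
    have hx01 : x ∈ Ioo (0 : ℝ) 1 := ⟨by linarith [hx.1], hx.2⟩
    have hpos : (0 : ℝ) < 1 - x := by linarith [hx.2]
    have hne : ((1 - x : ℝ) : ℂ) ≠ 0 := by exact_mod_cast hpos.ne'
    have h1 := hbranch x hx
    rw [hP x hx01, hPq, eval_mul, eval_pow, eval_sub, eval_X, eval_C] at h1
    -- `(x − 1)^n q(x) = (1−x)^μ G(x)`  ⇒  `G(x) = (1−x)^{−μ} (x−1)^n q(x)`
    have hG' : G x = ((1 - x : ℝ) : ℂ) ^ (-μ) * (((x : ℂ) - 1) ^ n * q.eval (x : ℂ)) := by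
      rw [h1, ← mul_assoc, ← Complex.cpow_add _ _ hne, neg_add_cancel, Complex.cpow_zero, one_mul]
    rw [hG', hQdef, Complex.cpow_sub _ _ hne, Complex.cpow_natCast]
    have e2 : ((x : ℂ) - 1) = -((1 - x : ℝ) : ℂ) := by push_cast; ring
    rw [e2, neg_pow, Complex.cpow_neg]
    field_simp
    ring
  obtain ⟨n', hn'⟩ := natural_of_smooth_branch he hQs hQ1 hG hagree
  -- `μ = n − n'` is an integer `≤ n ≤ N − 1`
  have hμ : μ = ((n : ℤ) - (n' : ℤ) : ℤ) := by
    push_cast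
    linear_combination -hn'
  exact hoff _ (by omega) hμ


end SpinFlipTS

end Summit.Ventures.KdS
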